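import Summits.BirchSwinnertonDyer.BirchSwinnertonDyer.Theorems.ManinLocalTwoThreeManinPrimeToAdditiveFiveLeKPCoreOfKP57
import Summits.BirchSwinnertonDyer.BirchSwinnertonDyer.Theorems.ManinLocalTwoThreeManinPrimeToAdditiveFiveLeReducibleResidueOfFacts
import HarnessLib

/-!
# Route `ManinLocalTwoThree`, residual crux C5 `ManinPrimeToAdditiveFiveLe`
# (stmt-BirchSwinnertonDyer-22969), line `upper_anchor`: THE LINE LEDGER —
# **C5 BY NAME ⟸ six PRINTED facts + one REGISTERED open crux (KP57) + two explicit OPEN cores**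

Glue (allocation δ″ of the lead bsd-line-ml23-c5-p1, HOME INBOX 2026-08-28T06:18:39Z) of
* the lead's `maninLocalTwoThree_maninPrimeToAdditiveFiveLe_of_kato_of_kp57_of_reducible` (p609325):
  C5 ⟸ F′ ∧ F″ ∧ ČNS ∧ Cremona(≤ 5·10⁵) ∧ KP57 ∧ (RED), where (RED) is VERBATIM the registered stub
  `stub_reducibleTwistMinimal` (the `W[p]`-reducible residue) and KP57 is the registered crux
  `EdixhovenFibreFiveSeven.KPResidueManinUnitFiveSeven` (stmt-BirchSwinnertonDyer-23810) BY NAME;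
* the width seat's `reducibleTwistMinimal_of_edixhoven_cns_of_cores` (p608852):
  (RED) ⟸ Edixhoven 1991 Thm. 3 (both cite-only halves) ∧ ČNS Thm. 1.2 ∧ RED(57) ∧ RED(11).

So `maninPrimeToAdditiveFiveLe_of_print_of_kp57_of_reducibleCores`: crux C5
`Summit.BirchSwinnertonDyer.BirchSwinnertonDyer.Theses.ManinLocalTwoThree.ManinPrimeToAdditiveFiveLe`
FOLLOWS from
* six PRINTED, statement-only Literature facts, none a hypothesis of C5: Kato F′
  `kato_neron_isIntegral_twistedSymbolSum_of_additive`, Kato F″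
  `kato_neron_isIntegral_twistedSymbolSum_of_additive_five_le`, Česnavičius–Neururer–Saha Thm. 1.2
  `cesnaviciusNeururerSaha_padicVal_maninConstant_le_modularDegree`, Cremona's table
  `cremona_abs_maninConstant_eq_one_of_level_le_500000`, Edixhoven 1991 Thm. 3 in its two halves
  `edixhoven_not_dvd_maninConstant_of_kodairaSymbol_ne` / `…_of_not_potentiallyGoodOrdinary`;
* ONE registered open crux: KP57 `KPResidueManinUnitFiveSeven` (stmt-23810, route
  `EdixhovenFibreFiveSeven`);
* TWO explicit open cores on globally twist-minimal classes with conductor-level lattice-optimal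
  data and `p² ∣ N`: RED(57) — `p ∈ {5,7}`, `E[p]` reducible; RED(11) — `p > 7`, `E[p]` reducible,
  Kodaira II/III/IV (`ord_p Δ_min ≤ 4`), potentially good ordinary in the (G)-shape, `p ∣ deg φ`
  (met in Cremona's range by the `X₀(13)` family R₁₃, lead's evidence #6 on 22969).

HONEST STATUS: conditional-result (`--supports … --as helper`); closes nothing. It records by name
that, granted print as transcribed in the tree, the open content of Manin's `p ∤ c` at an additive
`p ≥ 5` (crux C5) is KP57 ∪ RED(57) ∪ RED(11). Nothing here proves BSD, Manin's conjecture or C5.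
Seat bsd-line-ml23-c5-p1-w2 (width prover).

References: [Kato2004Asterisque] (8.1.3), Thm. 9.7; [KimNakamura2020] Cor. 2.4; [KostersPannekoek2017]
Thm. 1; [EdixhovenManin1991] Thm. 3; [CesnaviciusNeururerSaha2023] Thm. 1.2;
[Cremona2022ManinConstants]; [AgasheRibetStein2006] §2.
-/

set_option autoImplicit false
-- the Theorems namespace of this sub repeats the summit name by design (D-0017 nested layout)
set_option linter.dupNamespace false

noncomputable section

open scoped Classical NumberField

namespace Summit.BirchSwinnertonDyer.BirchSwinnertonDyer.Theorems

open WeierstrassCurve IsDedekindDomain NumberField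
  Literature.NumberTheory.EllipticCurves Literature.NumberTheory.EllipticCurves.ModularForms
  Literature.NumberTheory.EllipticCurves.Rank1Residual
  Summit.BirchSwinnertonDyer.Rank1Residual.ManinAdditive
  Summit.BirchSwinnertonDyer.BirchSwinnertonDyer.Theses.EdixhovenFibreFiveSeven

/-- **C5 `ManinPrimeToAdditiveFiveLe` BY NAME ⟸ six printed facts + KP57 + two open cores**
(the line `upper_anchor`'s ledger; conditional-result, C5 is NOT proved): Kato F′ (`hK`), Kato F″
(`hK57`), ČNS Thm. 1.2 (`hCNS`), Cremona ≤ 5·10⁵ (`h500k`), the registered crux KP57 BY NAME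
(`hKP57`), Edixhoven Thm. 3 Kodaira half (`hEdK`) and ordinarity half (`hEdG`); cores RED(57) (`h57`)
and RED(11) (`h11`). Proof: the lead's reduction p609325 fed with the width seat's p608852.
[cite: Kato2004Asterisque, (8.1.3) (p. 180), Thm. 9.7 (p. 189)] [cite: EdixhovenManin1991, Thm. 3]
[cite: CesnaviciusNeururerSaha2023, Thm. 1.2] [cite: KostersPannekoek2017, Thm. 1 and Cor. 2] -/
theorem maninPrimeToAdditiveFiveLe_of_print_of_kp57_of_reducibleCores
    (hK : kato_neron_isIntegral_twistedSymbolSum_of_additive)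
    (hK57 : kato_neron_isIntegral_twistedSymbolSum_of_additive_five_le)
    (hCNS : cesnaviciusNeururerSaha_padicVal_maninConstant_le_modularDegree)
    (h500k : cremona_abs_maninConstant_eq_one_of_level_le_500000)
    (hKP57 : KPResidueManinUnitFiveSeven)
    (hEdK : edixhoven_not_dvd_maninConstant_of_kodairaSymbol_ne)
    (hEdG : edixhoven_not_dvd_maninConstant_of_not_potentiallyGoodOrdinary)
    (h57 : mazur_not_dvd_maninConstant_of_odd → abbesUllmo_not_dvd_maninConstant_of_not_dvd_level →
      cesnavicius_not_two_dvd_maninConstant_of_two_dvd_level → exists_isNewformOf →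
      ∀ (W : WeierstrassCurve ℚ) [W.IsElliptic] [W.IsGloballyMinimal] [NeZero (W.conductorNorm ℤ)]
        (D : ModularParametrizationData W (W.conductorNorm ℤ)),
        IsLatticeOptimal D → ∀ p : ℕ, p.Prime → (p = 5 ∨ p = 7) → p ^ 2 ∣ W.conductorNorm ℤ →
        ¬ (∃ (W' : WeierstrassCurve ℚ) (q : ℕ), W'.IsElliptic ∧ W'.IsGloballyMinimal ∧ q.Prime ∧
            q ≠ 2 ∧ q ^ 2 ∣ W.conductorNorm ℤ ∧
            IsIsogenous W (W'.quadraticTwist (((-1 : ℤ) ^ (q / 2) * q : ℤ) : ℚ)) ∧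
            ¬ q ^ 2 ∣ W'.conductorNorm ℤ) →
        ¬ (∃ (W' : WeierstrassCurve ℚ) (d : ℤ), W'.IsElliptic ∧ W'.IsGloballyMinimal ∧
            (d = -1 ∨ d = 2 ∨ d = -2) ∧ 2 ^ 2 ∣ W.conductorNorm ℤ ∧
            IsIsogenous W (W'.quadraticTwist (d : ℚ)) ∧ ¬ 2 ^ 2 ∣ W'.conductorNorm ℤ) →
        ¬ W.HasIrreducibleModPGaloisRep p →
        ¬ (p : ℤ) ∣ D.maninConstant)
    (h11 : mazur_not_dvd_maninConstant_of_odd → abbesUllmo_not_dvd_maninConstant_of_not_dvd_level →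
      cesnavicius_not_two_dvd_maninConstant_of_two_dvd_level → exists_isNewformOf →
      ∀ (W : WeierstrassCurve ℚ) [W.IsElliptic] [W.IsGloballyMinimal] [NeZero (W.conductorNorm ℤ)]
        (D : ModularParametrizationData W (W.conductorNorm ℤ)),
        IsLatticeOptimal D → ∀ p : ℕ, p.Prime → 7 < p → p ^ 2 ∣ W.conductorNorm ℤ →
        ¬ (∃ (W' : WeierstrassCurve ℚ) (q : ℕ), W'.IsElliptic ∧ W'.IsGloballyMinimal ∧ q.Prime ∧
            q ≠ 2 ∧ q ^ 2 ∣ W.conductorNorm ℤ ∧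
            IsIsogenous W (W'.quadraticTwist (((-1 : ℤ) ^ (q / 2) * q : ℤ) : ℚ)) ∧
            ¬ q ^ 2 ∣ W'.conductorNorm ℤ) →
        ¬ (∃ (W' : WeierstrassCurve ℚ) (d : ℤ), W'.IsElliptic ∧ W'.IsGloballyMinimal ∧
            (d = -1 ∨ d = 2 ∨ d = -2) ∧ 2 ^ 2 ∣ W.conductorNorm ℤ ∧
            IsIsogenous W (W'.quadraticTwist (d : ℚ)) ∧ ¬ 2 ^ 2 ∣ W'.conductorNorm ℤ) →
        ¬ W.HasIrreducibleModPGaloisRep p →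
        padicValInt p W.minimalDiscriminantInt ≤ 4 →
        (∃ (L : Type) (_ : Field L) (_ : NumberField L) (_ : IsCyclotomicExtension {p} ℚ L)
            (F : IntermediateField ℚ L),
            ∀ w : HeightOneSpectrum (𝓞 F), (p : 𝓞 F) ∈ w.asIdeal →
              (W.baseChange F).HasGoodReductionAt w ∧ (W.baseChange F).HasUnitRootAt w) →
        p ∣ D.modularDegree →
        ¬ (p : ℤ) ∣ D.maninConstant) :
    Summit.BirchSwinnertonDyer.BirchSwinnertonDyer.Theses.ManinLocalTwoThree.ManinPrimeToAdditiveFiveLe :=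
  maninLocalTwoThree_maninPrimeToAdditiveFiveLe_of_kato_of_kp57_of_reducible hK hK57 hCNS h500k hKP57
    (reducibleTwistMinimal_of_edixhoven_cns_of_cores hEdK hEdG hCNS h57 h11)

end Summit.BirchSwinnertonDyer.BirchSwinnertonDyer.Theorems

end
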